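/-
Copyright: statement-level skeleton of a published paper (lit-balaban cell, Phase-2 proof seat p19, gen 4). No claims beyond
what the kernel checks below.
-/
import Mathlib
import Literature.MathematicalPhysics.QuantumFieldTheory.Balaban1983to89.B3IBPDegrees
import Literature.MathematicalPhysics.QuantumFieldTheory.Balaban1983to89.B3IBPKernelBounds

/-!
# B3 — T. Bałaban, *(Higgs)₂,₃ quantum fields in a finite volume. III. Renormalization*, CMP **88** (1983) 411–445
[Balaban1983Higgs3] — Sect. 2, pp. 425–426: the graphs `G′∗` produced by the integration by parts (2.8)/(2.9) are again
localized lattice graph amplitudes obeying (2.10)–(2.12) — with the derivative moved: *"if the propagator is differentiated,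
then for each differentiation, there is an additional factor (L^jη)^{−1} on the right side. This applies also to Hölder
norms"*

statement-level skeleton of published theorems with citation tags; proofs where landed; nothing here is a claim about
the Yang–Mills mass gap

PDF held: `paper:balaban1983-higgs-2-3-quantum-fields-finite-volume` (journal page = PDF page + 410); displays (2.8)–(2.10)
and the sentences around them read on the ×2 renders `pub-balaban/b2b-balaban-ref1/pages/1983-cmp88-higgs23-III/
1983-cmp88-higgs23-III-p015, p016-x2.png` (pp. 425–426).

Part of the Phase-2 work on SKELETON rows **B3.Prop2.1 / B3.Prop2.2** (unit `lit-balaban-p19` gen 4, HOME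
`run/shared/lean/pub/lit-balaban/`): the (2.4) EXCEPTION of Proposition 2.1, files `B3LatticeIBP` → `B3AmpIBP` →
`B3AmpIBPClosed` → `B3AmpIBPAll` → `B3IBPSites` → `B3IBPDegrees`, `B3IBPKernelBounds` → `B3AmpIBPBounds` (this file) →
`B3Prop21Except24`.

WHAT IS REPRODUCED.  p. 426 [PDF 16], verbatim: *"For the propagators G^η_{(j)} we apply the inequality |G^η_{(j)}(Ω, B̃; x,
x′)| ≦ O(1)(L^jη)^{−d+2}e^{−δ₁(L^jη)^{−1}|x−x′|}, (2.10) and if the propagator is differentiated, then for each differentiation,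
there is an additional factor (L^jη)^{−1} on the right side. This applies also to Hölder norms"*, and p. 425: *"The effect of
this transformation is that the graphs (2.4) are replaced by the graphs with degree +1."*  KERNEL-CHECKED HERE: the class
**`IBPAmp G`** of localized lattice graph amplitudes (`B3Ineq213Amplitude.Amp`) which are READY for the integration by parts —
a bond direction `dir v` per vertex (the derivative leg of (1.8)/(1.9), p. 413); for every differentiated line `l` with two
endpoints the undifferentiated kernel `K♭_l` with `K_l = ∂⁺_{dir s(l)}K♭_l` obeying (2.10) with one factor `(L^jη)^{−1}` less;
the vertex function at `s(l)` vanishing on the `dir s(l)`-faces of its cube (smooth localization supported inside the cube) with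
difference quotient bounded by `cD ×` the vertex bound (*"This applies also to Hölder norms"*: the norm (1.32) contains the
first derivatives); and (2.10) for the kernels with up to one more difference quotient in each variable (`KdX_le`, `KdY_le`,
`KdXY_le`: *"for each differentiation … an additional factor (L^jη)^{−1}"*) — and the THEOREM that every term `G′∗_c` of
`B3AmpIBPAll` (sites `S ⊆ sites G`, choice `c`) is again an amplitude of the class `Amp`, over the moved count datum
`B3IBPDegrees.moveCounts G S c` (**`IBPAmp.term`**): its kernels obey (2.10) with the MOVED dimensions (`a_l + 1` on the
sites, `a_p − #hits` elsewhere; constants `× (1 + e^{δ₁})²` from the shifted arguments `x − ηe_μ`), its vertex functions the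
vertex bound (`× cD` where differentiated); hence `E(G′(j)) = Σ_c E_{term c}(j)` (`IBPAmp.E_eq_sum_terms`) with each term ready
for (2.13)/(2.15), and `pref(term c) ≤ cD^m · pref` (`term_pref_le`).
-/

open Finset

namespace Literature.MathematicalPhysics.QuantumFieldTheory.Balaban1983to89.B3Ineq213

open B3Ineq215

/-! ## The class of IBP-ready amplitudes -/

section Ready

variable {V : Type} [Fintype V] [DecidableEq V] {m : ℕ}

/-- **An IBP-READY localized lattice graph amplitude** over the count datum `G`: an amplitude of the class `Amp` with, in
addition, a bond direction per vertex; for every differentiated line `l` with two endpoints (`s(l) ≠ t(l)`, `1 ≤` the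
differentiations of `s(l)` on `l`) the undifferentiated kernel `K♭_l`, `K_l = ∂⁺_{dir s(l)} K♭_l` in the first variable
(mesh `η = L^{−k}`), obeying (2.10) with the dimension `a_l + 1`, and the vertex function at `s(l)` vanishing on the
`dir s(l)`-faces of `□(s(l))` with `|∂⁻ u_{s(l)}| ≤ cD ×` the vertex bound; and the derivative budget (2.10) of every kernel.
[cite: Balaban1983Higgs3, (2.8) p.425] -/
structure IBPAmp (G : Counts V m) extends Amp G.toModel where
  /-- the bond direction of the derivative leg at each vertex -/
  dir : V → Fin G.toModel.d
  /-- the undifferentiated kernels `K♭_l` -/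
  Kb : Fin m → Ker G.toModel.d
  /-- the constant of the differentiated vertex bound -/
  cD : ℝ
  one_le_cD : 1 ≤ cD
  /-- `K_l = ∂⁺_{dir s(l)} K♭_l` in the first variable, on every differentiated line with two endpoints -/
  K_eq : ∀ l, G.src l ≠ G.tgt l → 1 ≤ G.diffOn (G.src l) l → ∀ t x y,
    K l t x y = fdiffQ ((G.toModel.L : ℝ) ^ k) (dir (G.src l)) (fun x' => Kb l t x' y) x
  /-- (2.10) for `K♭_l` with the dimension `a_l + 1` -/
  Kb_le : ∀ l, G.src l ≠ G.tgt l → 1 ≤ G.diffOn (G.src l) l → KBd G.toModel k (C l) (G.toModel.a l + 1) (Kb l)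
  /-- the vertex function at `s(l)` vanishes on the two `dir s(l)`-faces of its cube -/
  u_face : ∀ l, G.src l ≠ G.tgt l → 1 ≤ G.diffOn (G.src l) l →
    FaceVanishing G.toModel.L (⟨k, box (G.src l)⟩ : Cube G.toModel.d) (dir (G.src l)) (u (G.src l))
  /-- the differentiated vertex bound -/
  du_le : ∀ l, G.src l ≠ G.tgt l → 1 ≤ G.diffOn (G.src l) l → ∀ x,
    |bdiffQ ((G.toModel.L : ℝ) ^ k) (dir (G.src l)) (u (G.src l)) x|
      ≤ cD * (eRun ^ dv (G.src l) * lamRun ^ ds (G.src l) * NPhi (G.src l) * NA (G.src l)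
        * (((G.toModel.L : ℝ) ^ k)⁻¹) ^ G.toModel.e (G.src l))
  /-- (2.10) with one more difference quotient in the first variable -/
  KdX_le : ∀ l μ, KBd G.toModel k (C l) (G.toModel.a l - 1) (dK ((G.toModel.L : ℝ) ^ k) μ true false (K l))
  /-- (2.10) with one more difference quotient in the second variable -/
  KdY_le : ∀ l ν, KBd G.toModel k (C l) (G.toModel.a l - 1) (dK ((G.toModel.L : ℝ) ^ k) ν false true (K l))
  /-- (2.10) with one more difference quotient in each variable -/
  KdXY_le : ∀ l μ ν, KBd G.toModel k (C l) (G.toModel.a l - 2)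
    (dK ((G.toModel.L : ℝ) ^ k) μ true false (dK ((G.toModel.L : ℝ) ^ k) ν false true (K l)))

namespace IBPAmp

variable {G : Counts V m} (A : IBPAmp G)

/-- The derivative budget of each kernel. [cite: Balaban1983Higgs3, (2.10) p.426] -/
theorem budget (l : Fin m) : KBudget G.toModel A.k (A.C l) (G.toModel.a l) (A.K l) :=
  ⟨A.K_le l, A.KdX_le l, A.KdY_le l, A.KdXY_le l⟩

/-! ## The terms `G′∗_c` are amplitudes of the class `Amp` -/

variable {S : Finset (Fin m)} {c : Fin m → Option (Fin m)}

/-- The vertex-field norms of the term: a factor `cD` where the vertex function was differentiated. [cite: Balaban1983Higgs3, (2.9) p.425] -/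
noncomputable def NAc (S : Finset (Fin m)) (c : Fin m → Option (Fin m)) (v : V) : ℝ :=
  if (∃ l ∈ S, G.src l = v ∧ c l = none) then A.cD * A.NA v else A.NA v

/-- A site line is hit by no site (sites are vertex-disjoint). [cite: Balaban1983Higgs3, (2.9) p.425] -/
theorem nHit_of_mem (hS : S ⊆ sites G) (hc : c ∈ choices G.src G.tgt S) {q : Fin m} (hq : q ∈ S) :
    nHit S c q = 0 := by
  have hSS := (sites_isSiteSet G).mono hS
  unfold nHit
  rw [card_eq_zero, filter_eq_empty_iff]
  rintro l hl ⟨hlq, hcl⟩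
  obtain ⟨-, -, ht⟩ := choice_some G.src G.tgt hc hcl
  rcases ht with h | h
  · exact hSS.src_ne_src l hl q hq hlq h.symm
  · exact hSS.src_ne_tgt l hl q hq hlq h.symm

/-- The operation codes are at most `2`. [cite: Balaban1983Higgs3, (2.9) p.425] -/
theorem xcode_le_two (q : Fin m) : xcode G.src S c q ≤ 2 := Finset.sup_le fun _ _ => opCode_le_two _ _

/-- The operation codes are at most `2`. [cite: Balaban1983Higgs3, (2.9) p.425] -/
theorem ycode_le_two (q : Fin m) : ycode G.src G.tgt S c q ≤ 2 := Finset.sup_le fun _ _ => opCode_le_two _ _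

/-- **The kernels of the term `c` obey (2.10) with the moved dimensions** and the constants `C_l (1 + e^{2δ₀})²`.
[cite: Balaban1983Higgs3, (2.10) p.426] -/
theorem term_K_le (hS : S ⊆ sites G) (hc : c ∈ choices G.src G.tgt S) (q : Fin m) :
    KBd G.toModel A.k (A.C q * (1 + Esh G.toModel) ^ 2) ((moveCounts G S c).toModel.a q)
      (allK G.src G.tgt A.dir ((G.toModel.L : ℝ) ^ A.k) A.Kb S c A.K q) := by
  have hS1 : ∀ l ∈ S, 1 ≤ G.diffOn (G.src l) l := fun l hl => (mem_sites.1 (hS hl)).2.1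
  have hE := one_le_Esh G.toModel
  have hCq : 0 ≤ A.C q := A.C_nonneg q
  have hC1 : A.C q ≤ A.C q * (1 + Esh G.toModel) ^ 2 :=
    le_mul_of_one_le_right hCq (one_le_pow₀ (by linarith))
  rw [toModel_a_moveCounts G hS1 c q]
  by_cases hq : q ∈ S
  · -- a site line: `K♭`, dimension `a + 1`
    have hsite := mem_sites.1 (hS hq)
    rw [if_pos hq, nHit_of_mem hS hc hq, Nat.cast_zero, sub_zero]
    have hK : allK G.src G.tgt A.dir ((G.toModel.L : ℝ) ^ A.k) A.Kb S c A.K q = A.Kb q := by simp [allK, hq]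
    rw [hK]
    exact (A.Kb_le q hsite.1 hsite.2.1).mono hC1
  · rw [if_neg hq, add_zero, nHit_eq_codes G ((sites_isSiteSet G).mono hS) hc q]
    unfold allK
    rw [if_neg hq]
    by_cases hloop : G.src q = G.tgt q
    · have hexp : ((if xcode G.src S c q = 2 then 1 else 0)
          + (if G.src q ≠ G.tgt q ∧ ycode G.src G.tgt S c q = 2 then 1 else 0) : ℕ) = nd (xcode G.src S c q) := by
        rw [if_neg (show ¬ (G.src q ≠ G.tgt q ∧ ycode G.src G.tgt S c q = 2) from fun h => h.1 hloop), add_zero]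
        rfl
      rw [if_pos hloop, hexp]
      exact (A.budget q).apCode_bound_loop hCq (xcode_le_two q) _
    · rw [if_neg hloop]
      have h := (A.budget q).apCode_bound hCq (xcode_le_two (G := G) (S := S) (c := c) q)
        (ycode_le_two (G := G) (S := S) (c := c) q) (A.dir (G.src q)) (A.dir (G.tgt q))
      simp only [nd, ne_eq, hloop, not_false_eq_true, true_and] at h ⊢
      exact h

/-- **The vertex functions of the term `c` obey the vertex bound** (`× cD` where differentiated).
[cite: Balaban1983Higgs3, (2.9) p.425] -/
theorem term_u_le (hS : S ⊆ sites G) (v : V) (x : Fin G.toModel.d → ℕ) :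
    |allU G.src A.dir ((G.toModel.L : ℝ) ^ A.k) S c A.u v x|
      ≤ A.eRun ^ A.dv v * A.lamRun ^ A.ds v * A.NPhi v * A.NAc S c v
        * (((G.toModel.L : ℝ) ^ A.k)⁻¹) ^ (moveCounts G S c).toModel.e v := by
  have he : (moveCounts G S c).toModel.e v = G.toModel.e v := rfl
  rw [he]
  unfold allU NAc
  by_cases h1 : ∃ l ∈ S, G.src l = v
  · rw [if_pos h1]
    obtain ⟨l, hl, hlv⟩ := h1
    have hsite := mem_sites.1 (hS hl)
    by_cases h2 : ∃ l ∈ S, G.src l = v ∧ c l = none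
    · rw [if_pos h2, if_pos h2, abs_neg, ← hlv]
      calc |bdiffQ ((G.toModel.L : ℝ) ^ A.k) (A.dir (G.src l)) (A.u (G.src l)) x|
          ≤ A.cD * (A.eRun ^ A.dv (G.src l) * A.lamRun ^ A.ds (G.src l) * A.NPhi (G.src l) * A.NA (G.src l)
              * (((G.toModel.L : ℝ) ^ A.k)⁻¹) ^ G.toModel.e (G.src l)) := A.du_le l hsite.1 hsite.2.1 x
        _ = _ := by ring
    · rw [if_neg h2, if_neg h2, abs_neg]
      exact A.u_le v _
  · have h2 : ¬ ∃ l ∈ S, G.src l = v ∧ c l = none := fun ⟨l, hl, hv, _⟩ => h1 ⟨l, hl, hv⟩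
    rw [if_neg h1, if_neg h2]
    exact A.u_le v x

/-- **The term `G′∗_c` as an amplitude of the class `Amp` over the moved count datum.** [cite: Balaban1983Higgs3, (2.9) p.425] -/
noncomputable def term (hS : S ⊆ sites G) (hc : c ∈ choices G.src G.tgt S) : Amp (moveCounts G S c).toModel where
  k := A.k
  box := A.box
  u := allU G.src A.dir ((G.toModel.L : ℝ) ^ A.k) S c A.u
  K := allK G.src G.tgt A.dir ((G.toModel.L : ℝ) ^ A.k) A.Kb S c A.K
  C := fun q => A.C q * (1 + Esh G.toModel) ^ 2
  eRun := A.eRun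
  lamRun := A.lamRun
  dv := A.dv
  ds := A.ds
  NPhi := A.NPhi
  NA := A.NAc S c
  C_nonneg := fun q => mul_nonneg (A.C_nonneg q) (sq_nonneg _)
  eRun_nonneg := A.eRun_nonneg
  lamRun_nonneg := A.lamRun_nonneg
  NPhi_nonneg := A.NPhi_nonneg
  NA_nonneg := fun v => by
    unfold NAc
    split_ifs
    · exact mul_nonneg (le_trans zero_le_one A.one_le_cD) (A.NA_nonneg v)
    · exact A.NA_nonneg v
  e_nonneg := A.e_nonneg
  conn := A.conn
  u_le := A.term_u_le hS
  K_le := fun q => A.term_K_le hS hc q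

/-- The amplitude of the term at `j` is the raw sum of its closed-form data. [cite: Balaban1983Higgs3, (2.9) p.425] -/
theorem term_E (hS : S ⊆ sites G) (hc : c ∈ choices G.src G.tgt S) (j : Fin m → ℕ) : (A.term hS hc).E j
    = rawE G.toModel.L G.toModel.d A.k G.src G.tgt A.box (allU G.src A.dir ((G.toModel.L : ℝ) ^ A.k) S c A.u)
        (allK G.src G.tgt A.dir ((G.toModel.L : ℝ) ^ A.k) A.Kb S c A.K) j := rfl

/-- **`E(G′(j)) = Σ_c E(G′∗_c(j))`** with each term an amplitude of the class `Amp` over its moved count datum (the sum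
runs over the choice functions with their membership proofs). [cite: Balaban1983Higgs3, (2.9) p.425] -/
theorem E_eq_sum_terms (hS : S ⊆ sites G) (j : Fin m → ℕ) :
    A.E j = ∑ c ∈ (choices G.src G.tgt S).attach, (A.term hS c.2).E j := by
  have hS1 := fun l (hl : l ∈ S) => mem_sites.1 (hS hl)
  have hsum : ∑ c ∈ (choices G.src G.tgt S).attach, (A.term hS c.2).E j
      = ∑ c ∈ choices G.src G.tgt S, rawE G.toModel.L G.toModel.d A.k G.src G.tgt A.box
          (allU G.src A.dir ((G.toModel.L : ℝ) ^ A.k) S c A.u)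
          (allK G.src G.tgt A.dir ((G.toModel.L : ℝ) ^ A.k) A.Kb S c A.K) j :=
    sum_attach (choices G.src G.tgt S) fun c => rawE G.toModel.L G.toModel.d A.k G.src G.tgt A.box
      (allU G.src A.dir ((G.toModel.L : ℝ) ^ A.k) S c A.u) (allK G.src G.tgt A.dir ((G.toModel.L : ℝ) ^ A.k) A.Kb S c A.K) j
  rw [hsum]
  exact A.E_allSites A.dir A.Kb j S ((sites_isSiteSet G).mono hS)
    (fun l hl x y => A.K_eq l (hS1 l hl).1 (hS1 l hl).2.1 (j l) x y) (fun l hl => A.u_face l (hS1 l hl).1 (hS1 l hl).2.1)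

/-! ## The prefactor of a term -/

/-- The set of vertices where the vertex function was differentiated has at most `m` elements (one per site).
[cite: Balaban1983Higgs3, (2.9) p.425] -/
theorem card_derived_le : (univ.filter fun v => ∃ l ∈ S, G.src l = v ∧ c l = none).card ≤ m := by
  calc (univ.filter fun v => ∃ l ∈ S, G.src l = v ∧ c l = none).card
      ≤ (S.image G.src).card := by
        refine card_le_card fun v hv => ?_
        obtain ⟨l, hl, hv, -⟩ := (mem_filter.1 hv).2
        exact mem_image.2 ⟨l, hl, hv⟩
    _ ≤ S.card := card_image_le
    _ ≤ m := (card_le_univ S).trans (by simp)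

/-- `Π_v NAc v ≤ cD^m · Π_v NA v`. [cite: Balaban1983Higgs3, (2.9) p.425] -/
theorem prod_NAc_le : ∏ v, A.NAc S c v ≤ A.cD ^ m * ∏ v, A.NA v := by
  classical
  have hcD := A.one_le_cD
  have h1 : ∏ v, A.NAc S c v = (∏ v, (if (∃ l ∈ S, G.src l = v ∧ c l = none) then A.cD else 1)) * ∏ v, A.NA v := by
    rw [← prod_mul_distrib]
    refine prod_congr rfl fun v _ => ?_
    unfold NAc
    split_ifs <;> simp
  rw [h1, prod_ite, prod_const_one, mul_one, prod_const]
  refine mul_le_mul_of_nonneg_right ?_ (prod_nonneg fun v _ => A.NA_nonneg v)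
  exact pow_le_pow_right₀ hcD card_derived_le

/-- **The prefactor of a term is at most `cD^m` times the prefactor of the amplitude.** [cite: Balaban1983Higgs3, (1.33) p.420] -/
theorem term_pref_le (hS : S ⊆ sites G) (hc : c ∈ choices G.src G.tgt S) :
    (A.term hS hc).pref ≤ A.cD ^ m * A.toAmp.pref := by
  have hk : (A.term hS hc).k = A.k := rfl
  have hbox : (A.term hS hc).box = A.box := rfl
  have hδ : (moveCounts G S c).δ₁ = G.δ₁ := rfl
  have hL : (moveCounts G S c).L = G.L := rfl
  show (A.term hS hc).eRun ^ (∑ v, (A.term hS hc).dv v) * (A.term hS hc).lamRun ^ (∑ v, (A.term hS hc).ds v)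
      * Real.exp (-((moveCounts G S c).δ₁ / 2 * boxTreeLen (moveCounts G S c).L (A.term hS hc).k (A.term hS hc).box))
      * (∏ v, (A.term hS hc).NPhi v) * ∏ v, (A.term hS hc).NA v
    ≤ A.cD ^ m * (A.eRun ^ (∑ v, A.dv v) * A.lamRun ^ (∑ v, A.ds v)
      * Real.exp (-(G.δ₁ / 2 * boxTreeLen G.L A.k A.box)) * (∏ v, A.NPhi v) * ∏ v, A.NA v)
  rw [hk, hbox, hδ, hL]
  have hmain := A.prod_NAc_le (S := S) (c := c)
  have h0 : 0 ≤ A.eRun ^ (∑ v, A.dv v) * A.lamRun ^ (∑ v, A.ds v) * Real.exp (-(G.δ₁ / 2 * boxTreeLen G.L A.k A.box))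
      * (∏ v, A.NPhi v) := by
    have := A.eRun_nonneg
    have := A.lamRun_nonneg
    have : 0 ≤ ∏ v, A.NPhi v := prod_nonneg fun v _ => A.NPhi_nonneg v
    positivity
  calc A.eRun ^ (∑ v, A.dv v) * A.lamRun ^ (∑ v, A.ds v) * Real.exp (-(G.δ₁ / 2 * boxTreeLen G.L A.k A.box))
        * (∏ v, A.NPhi v) * ∏ v, A.NAc S c v
      ≤ A.eRun ^ (∑ v, A.dv v) * A.lamRun ^ (∑ v, A.ds v) * Real.exp (-(G.δ₁ / 2 * boxTreeLen G.L A.k A.box))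
        * (∏ v, A.NPhi v) * (A.cD ^ m * ∏ v, A.NA v) := mul_le_mul_of_nonneg_left hmain h0
    _ = _ := by ring

/-- The product of the term's kernel constants. [cite: Balaban1983Higgs3, (2.13) p.426] -/
theorem term_prod_C (hS : S ⊆ sites G) (hc : c ∈ choices G.src G.tgt S) :
    ∏ q, (A.term hS hc).C q = (∏ q, A.C q) * ((1 + Esh G.toModel) ^ 2) ^ m := by
  show ∏ q, A.C q * (1 + Esh G.toModel) ^ 2 = _
  rw [prod_mul_distrib, prod_const, card_univ, Fintype.card_fin]

end IBPAmp

end Ready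

end Literature.MathematicalPhysics.QuantumFieldTheory.Balaban1983to89.B3Ineq213
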